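import Summits.QuantumFields.BalabanUV.T4Continuum.Support.BalabanAveragedTowerUnit

/-!
# T⁴ programme, spine node NE2 (U1a) — INVERSES ALONG A CONVERGENT TOWER: uniform coercivity ⟹ the inverses converge with
# the same geometric rate (kernel reduction), and the located input it isolates for the δ-FUNCTION objects of [B5]
# (`Δ_k` (1.65), `(QGQ*)^{−1}` (1.69)/(3.132)) at `U = 1`

Eighth generation of the NE2 prover lineage P1 of the cell `pub-balaban`, file 11 (Spine; bookkeeping + a typed input).
Files 2–10 prove, at `U = 1`, the η-rate of the SANDWICHED tower `c_k = n_k^d·Q_k𝒢Q_kᴴ` (Bałaban's (1.18) averaging,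
`𝒢 = Δ_a^{−1}`): `Support/BalabanAveragedTowerUnit.unitCovB_tendsto`.  The δ-function objects of node U1a (cell record
`t4/T4-XREAD-U1a.md`: X8 `Δ_k` — «⟨B, Δ_kB⟩ = ⟨∂H_kB, ∂H_kB⟩», [Balaban1984PropagatorsI] (1.65)–(1.66); X11 `(QGQ*)^{−1}`, (1.69) and
[Balaban1985BackgroundPropagators] (3.132)) are INVERSES of such sandwiches (at `U = 1`, by the Woodbury identity for
`Δ_a = (Δ − ∂P∂*) + a·n^dQ_kᴴQ_k`, `Δ_k + a = c_k^{−1}` on the unit lattice — a DICTIONARY item, NOT typed here).  This file supplies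
the inversion step of the rate transfer, abstractly and kernel-checked, and NAMES the one input it needs:

 * §1 `Coercive γ A` (`γ‖x‖² ≤ Re⟨x, Ax⟩` for all `x`): a coercive matrix is invertible (`isUnit_of_coercive`), `‖A⁻¹‖ ≤ γ⁻¹`
   (`opNorm_inv_le_of_coercive`), and **`opNorm_inv_sub_inv_le`**: `‖A⁻¹ − B⁻¹‖ ≤ γ⁻²‖A − B‖` for two `γ`-coercive matrices;
 * §2 towers: **`inverse_tower_of_coercive`** — if `c_k → c_∞` with `‖c_k − c_∞‖ ≤ Cρ^k/(1 − ρ)` and every `c_k` is `γ`-coercive,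
   then `c_∞` is `γ`-coercive, `c_k⁻¹ → c_∞⁻¹` and `‖c_k⁻¹ − c_∞⁻¹‖ ≤ γ⁻²·Cρ^k/(1 − ρ)`;
 * §3 the NE2 reading at `U = 1`: **`UniformCoercive L M a γ`** (every `unitCovB k` is `γ`-coercive — the TYPED INPUT; for
   Bałaban's objects it is an UPPER bound `Δ_k + a ≤ γ^{−1}` on the δ-function effective operator, of the type of the upper half
   of [B5] (1.67) p. 29 «γ₀⟨∂₁B, ∂₁B⟩ ≦ ⟨B, Δ_kB⟩ ≦ γ₁⟨∂₁B, ∂₁B⟩» with «positive constants γ₀, γ₁ dependent on d only» (render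
   `1984-cmp95-propagators-rt-I-p013-x2.png` read as an image by this seat; note the printed bound is in terms of the unit-lattice
   field strength `⟨∂₁B, ∂₁B⟩ ≤ const(d)·‖B‖²`) — NOT in the tree for these carriers and NOT asserted here) and
   **`inv_unitCovB_tendsto_of_uniformCoercive`**: under it, the inverses `(unitCovB k)⁻¹` converge with rate
   `γ⁻²·CQB·L^{−k}/(1 − L^{−1})`.  (v1.0.1: docstring-only — the (1.67) sentence is now quoted verbatim; declarations unchanged.)

HONEST FRAMING (T4-DAG p. 1).  §1–§2 are [folklore] linear algebra (resolvent identity, coercivity), statements OURS; §3 is a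
CONDITIONAL reduction whose hypothesis `UniformCoercive` is displayed by name — nothing of it is discharged, and the dictionary
`Δ_k = c_k^{−1} − a` is not typed.  `U = 1`, FIXED FINITE torus, linear layer; NOT `U ≠ 1` (open row G-an2-4), NOT infinite
volume, NOT a mass gap, NOT Clay, NOT summit progress.  HONEST DEPENDENCY: continuum YM on T⁴ ⇐ BetaPertH ∧ nine spine
estimates (0/9 proved); BetaPertH ⇐ (D1) ∧ (D4) ∧ CAP+tail; G-an2-4 gates asym, D1 and NE2/3/4.  ABSOLUTE RULE kept; no `sorry`.
-/

noncomputable section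

open scoped BigOperators ComplexConjugate Matrix Matrix.Norms.L2Operator
open Filter Topology

namespace Summit.QuantumFields.BalabanUV.T4Continuum.CoerciveInverseTower

open Literature.MathematicalPhysics.QuantumFieldTheory.Balaban1983to89.B5Prop11Plancherel (opNorm_le_of_sq_le)
open Literature.MathematicalPhysics.QuantumFieldTheory.Balaban1983to89.B5Prop11Lower (nsq nsq_nonneg nsq_mulVec_le
  norm_star_dotProduct_le)

/-! ## §1 Coercive matrices: invertibility, inverse bound, resolvent difference -/

section Coercive

variable {ι : Type*} [Fintype ι] [DecidableEq ι]

/-- `A` is `γ`-COERCIVE: `γ·Σ|x_i|² ≤ Re⟨x, A x⟩` for every vector `x`. [folklore] -/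
def Coercive (γ : ℝ) (A : Matrix ι ι ℂ) : Prop := ∀ x : ι → ℂ, γ * nsq x ≤ (star x ⬝ᵥ (A *ᵥ x)).re

omit [DecidableEq ι] in
/-- under coercivity, `Σ|x|² ≤ γ⁻²·Σ|Ax|²` (Cauchy–Schwarz on `Re⟨x, Ax⟩`). [folklore] -/
theorem nsq_le_of_coercive {γ : ℝ} (hγ : 0 < γ) {A : Matrix ι ι ℂ} (h : Coercive γ A) (x : ι → ℂ) :
    nsq x ≤ (γ⁻¹) ^ 2 * nsq (A *ᵥ x) := by
  have h1 : γ * nsq x ≤ Real.sqrt (nsq x) * Real.sqrt (nsq (A *ᵥ x)) :=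
    (h x).trans ((Complex.re_le_norm _).trans (norm_star_dotProduct_le x (A *ᵥ x)))
  have hx := nsq_nonneg x
  have hy := nsq_nonneg (A *ᵥ x)
  -- `γ √(nsq x) ≤ √(nsq (Ax))`
  have h2 : γ * Real.sqrt (nsq x) ≤ Real.sqrt (nsq (A *ᵥ x)) := by
    by_cases h0 : nsq x = 0
    · rw [h0, Real.sqrt_zero, mul_zero]; exact Real.sqrt_nonneg _
    · have hpos : 0 < Real.sqrt (nsq x) := Real.sqrt_pos.mpr (lt_of_le_of_ne hx (Ne.symm h0))
      have h3 : γ * Real.sqrt (nsq x) * Real.sqrt (nsq x) ≤ Real.sqrt (nsq (A *ᵥ x)) * Real.sqrt (nsq x) := by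
        rw [mul_assoc, Real.mul_self_sqrt hx, mul_comm (Real.sqrt (nsq (A *ᵥ x)))]; exact h1
      exact le_of_mul_le_mul_right h3 hpos
  have h4 : (γ * Real.sqrt (nsq x)) ^ 2 ≤ (Real.sqrt (nsq (A *ᵥ x))) ^ 2 :=
    pow_le_pow_left₀ (mul_nonneg hγ.le (Real.sqrt_nonneg _)) h2 2
  rw [mul_pow, Real.sq_sqrt hx, Real.sq_sqrt hy] at h4
  have hγ2 : 0 < γ ^ 2 := pow_pos hγ 2
  rw [inv_pow]
  calc nsq x = (γ ^ 2)⁻¹ * (γ ^ 2 * nsq x) := by rw [← mul_assoc, inv_mul_cancel₀ hγ2.ne', one_mul]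
    _ ≤ (γ ^ 2)⁻¹ * nsq (A *ᵥ x) := mul_le_mul_of_nonneg_left h4 (inv_nonneg.mpr hγ2.le)

/-- a coercive matrix has trivial kernel, hence is invertible. [folklore] -/
theorem isUnit_of_coercive {γ : ℝ} (hγ : 0 < γ) {A : Matrix ι ι ℂ} (h : Coercive γ A) : IsUnit A := by
  refine (Matrix.mulVec_injective_iff_isUnit).mp fun x y hxy => ?_
  have h0 : A *ᵥ (x - y) = 0 := by rw [Matrix.mulVec_sub, hxy, sub_self]
  have h1 := nsq_le_of_coercive hγ h (x - y)
  rw [h0] at h1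
  have h2 : nsq (x - y) ≤ 0 := by simpa [nsq] using h1
  have h3 : nsq (x - y) = 0 := le_antisymm h2 (nsq_nonneg _)
  have h4 : ∀ i, (x - y) i = 0 := by
    intro i
    have := Finset.sum_eq_zero_iff_of_nonneg (fun i _ => sq_nonneg (‖(x - y) i‖)) |>.mp h3 i (Finset.mem_univ i)
    exact norm_eq_zero.mp (pow_eq_zero_iff two_ne_zero |>.mp this)
  funext i
  exact sub_eq_zero.mp (h4 i)

/-- **`‖A⁻¹‖ ≤ γ⁻¹`** for a `γ`-coercive matrix. [folklore] -/
theorem opNorm_inv_le_of_coercive {γ : ℝ} (hγ : 0 < γ) {A : Matrix ι ι ℂ} (h : Coercive γ A) : ‖A⁻¹‖ ≤ γ⁻¹ := by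
  have hU := isUnit_of_coercive hγ h
  have hdet : IsUnit A.det := (Matrix.isUnit_iff_isUnit_det A).mp hU
  refine opNorm_le_of_sq_le _ (inv_nonneg.mpr hγ.le) fun y => ?_
  have h1 := nsq_le_of_coercive hγ h (A⁻¹ *ᵥ y)
  rw [Matrix.mulVec_mulVec, Matrix.mul_nonsing_inv A hdet, Matrix.one_mulVec] at h1
  simpa [nsq, Matrix.mulVec, dotProduct] using h1

/-- the resolvent identity `A⁻¹ − B⁻¹ = A⁻¹ (B − A) B⁻¹` for invertible `A`, `B`. [folklore] -/
theorem inv_sub_inv_eq {A B : Matrix ι ι ℂ} (hA : IsUnit A.det) (hB : IsUnit B.det) :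
    A⁻¹ - B⁻¹ = A⁻¹ * (B - A) * B⁻¹ := by
  rw [Matrix.mul_sub, Matrix.sub_mul, Matrix.mul_assoc, Matrix.mul_nonsing_inv B hB, Matrix.mul_one,
    Matrix.nonsing_inv_mul A hA, Matrix.one_mul]

/-- **`‖A⁻¹ − B⁻¹‖ ≤ γ⁻²·‖A − B‖`** for two `γ`-coercive matrices. [folklore] -/
theorem opNorm_inv_sub_inv_le {γ : ℝ} (hγ : 0 < γ) {A B : Matrix ι ι ℂ} (hA : Coercive γ A) (hB : Coercive γ B) :
    ‖A⁻¹ - B⁻¹‖ ≤ (γ⁻¹) ^ 2 * ‖A - B‖ := by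
  have hAd : IsUnit A.det := (Matrix.isUnit_iff_isUnit_det A).mp (isUnit_of_coercive hγ hA)
  have hBd : IsUnit B.det := (Matrix.isUnit_iff_isUnit_det B).mp (isUnit_of_coercive hγ hB)
  rw [inv_sub_inv_eq hAd hBd]
  have h1 := opNorm_inv_le_of_coercive hγ hA
  have h2 := opNorm_inv_le_of_coercive hγ hB
  have h0 : 0 ≤ γ⁻¹ := inv_nonneg.mpr hγ.le
  calc ‖A⁻¹ * (B - A) * B⁻¹‖ ≤ ‖A⁻¹‖ * ‖B - A‖ * ‖B⁻¹‖ :=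
        (Matrix.l2_opNorm_mul _ _).trans (mul_le_mul_of_nonneg_right (Matrix.l2_opNorm_mul _ _) (norm_nonneg _))
    _ ≤ γ⁻¹ * ‖B - A‖ * γ⁻¹ := mul_le_mul (mul_le_mul_of_nonneg_right h1 (norm_nonneg _)) h2 (norm_nonneg _)
        (mul_nonneg h0 (norm_nonneg _))
    _ = (γ⁻¹) ^ 2 * ‖A - B‖ := by rw [norm_sub_rev]; ring

/-! ## §2 Inverses along a convergent tower -/

omit [DecidableEq ι] in
/-- coercivity passes to limits. [folklore] -/
theorem coercive_of_tendsto {γ : ℝ} {c : ℕ → Matrix ι ι ℂ} (hc : ∀ k, Coercive γ (c k)) {cinf : Matrix ι ι ℂ}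
    (hlim : Tendsto c atTop (𝓝 cinf)) : Coercive γ cinf := by
  intro x
  have hcont : Continuous fun Y : Matrix ι ι ℂ => (star x ⬝ᵥ (Y *ᵥ x)).re := by
    refine Complex.continuous_re.comp ?_
    exact (continuous_const.dotProduct (Continuous.matrix_mulVec continuous_id continuous_const))
  have h1 : Tendsto (fun k => (star x ⬝ᵥ (c k *ᵥ x)).re) atTop (𝓝 ((star x ⬝ᵥ (cinf *ᵥ x)).re)) :=
    (hcont.tendsto cinf).comp hlim
  exact ge_of_tendsto h1 (Filter.Eventually.of_forall fun k => hc k x)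

/-- **INVERSES ALONG A CONVERGENT TOWER**: if every `c_k` is `γ`-coercive and `c_k → c_∞` with `‖c_k − c_∞‖ ≤ Cρ^k/(1 − ρ)`,
then `c_∞` is `γ`-coercive, `c_k⁻¹ → c_∞⁻¹`, and `‖c_k⁻¹ − c_∞⁻¹‖ ≤ γ⁻²·Cρ^k/(1 − ρ)`. [folklore] -/
theorem inverse_tower_of_coercive {γ : ℝ} (hγ : 0 < γ) {c : ℕ → Matrix ι ι ℂ} (hc : ∀ k, Coercive γ (c k))
    {cinf : Matrix ι ι ℂ} (hlim : Tendsto c atTop (𝓝 cinf)) {C ρ : ℝ} (hρ0 : 0 ≤ ρ) (hρ1 : ρ < 1)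
    (hrate : ∀ k, ‖c k - cinf‖ ≤ C * ρ ^ k / (1 - ρ)) :
    Coercive γ cinf ∧ Tendsto (fun k => (c k)⁻¹) atTop (𝓝 cinf⁻¹) ∧
      ∀ k, ‖(c k)⁻¹ - cinf⁻¹‖ ≤ (γ⁻¹) ^ 2 * (C * ρ ^ k / (1 - ρ)) := by
  have hinf := coercive_of_tendsto hc hlim
  have hb : ∀ k, ‖(c k)⁻¹ - cinf⁻¹‖ ≤ (γ⁻¹) ^ 2 * (C * ρ ^ k / (1 - ρ)) := fun k =>
    (opNorm_inv_sub_inv_le hγ (hc k) hinf).trans (mul_le_mul_of_nonneg_left (hrate k) (sq_nonneg _))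
  refine ⟨hinf, ?_, hb⟩
  have hgeo : Tendsto (fun k => (γ⁻¹) ^ 2 * (C * ρ ^ k / (1 - ρ))) atTop (𝓝 0) := by
    have h1 : Tendsto (fun k => ρ ^ k) atTop (𝓝 0) := tendsto_pow_atTop_nhds_zero_of_lt_one hρ0 hρ1
    have h2 : Tendsto (fun k => (γ⁻¹) ^ 2 * (C * ρ ^ k / (1 - ρ))) atTop (𝓝 ((γ⁻¹) ^ 2 * (C * 0 / (1 - ρ)))) :=
      ((h1.const_mul C).div_const (1 - ρ)).const_mul _
    simpa using h2
  rw [tendsto_iff_norm_sub_tendsto_zero]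
  exact squeeze_zero (fun k => norm_nonneg _) hb hgeo

end Coercive

/-! ## §3 The NE2 reading at `U = 1`: the δ-function objects as inverses of the sandwiched tower -/

section UnitLattice

open Literature.MathematicalPhysics.QuantumFieldTheory.Balaban1983to89.B5Prop11Plancherel
open Summit.QuantumFields.BalabanUV.T4Continuum.BalabanLineAverage
open Summit.QuantumFields.BalabanUV.T4Continuum.BalabanAveragedTowerUnit

variable {d : ℕ} (L : ℕ) [NeZero L] (M : Fin d → ℕ) [hM : ∀ μ, NeZero (M μ)] (a : ℝ) (ha : 0 < a)

/-- **THE TYPED INPUT — UNIFORM COERCIVITY of the (1.18)-averaged unit-lattice free covariance**: every `c_k = unitCovB k` is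
`γ`-coercive with ONE `γ > 0`.  For Bałaban's objects (dictionary `Δ_k + a = c_k^{−1}`, Woodbury — not typed) this is the UPPER
bound `Δ_k ≤ γ^{−1} − a` on the δ-function effective operator, of the type of the upper half of the printed (1.67)
«γ₀⟨∂₁B, ∂₁B⟩ ≦ ⟨B, Δ_kB⟩ ≦ γ₁⟨∂₁B, ∂₁B⟩» («positive constants γ₀, γ₁ dependent on d only»); NOT in the tree for these carriers;
ASSERTED BY NOBODY here — a hypothesis shape. [cite: Balaban1984PropagatorsI, (1.65)-(1.67) p.29 (type of the input)] -/
def UniformCoercive (γ : ℝ) : Prop := ∀ k, Coercive γ (unitCovB L M a ha k)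

/-- **CONDITIONAL RATE FOR THE INVERSES** (`L ≥ 2`): under `UniformCoercive γ`, the inverses `c_k⁻¹` (⇝ `Δ_k + a`, `(QGQ*)^{−1}`
up to the untyped dictionary) CONVERGE with `‖c_k⁻¹ − c_∞⁻¹‖ ≤ γ⁻²·CQB(d,a)·L^{−k}/(1 − L^{−1})` — the sandwiched rate of file 3
transfers to the δ-function side through §2.  The coercivity is NOT discharged. [folklore] -/
theorem inv_unitCovB_tendsto_of_uniformCoercive (hL : 2 ≤ L) {γ : ℝ} (hγ : 0 < γ) (hco : UniformCoercive L M a ha γ) :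
    ∃ cinf : Matrix (idx L M 0) (idx L M 0) ℂ,
      Tendsto (unitCovB L M a ha) atTop (𝓝 cinf) ∧ Coercive γ cinf ∧
      Tendsto (fun k => (unitCovB L M a ha k)⁻¹) atTop (𝓝 cinf⁻¹) ∧
      ∀ k, ‖(unitCovB L M a ha k)⁻¹ - cinf⁻¹‖ ≤ (γ⁻¹) ^ 2 * (CQB d a * ((L : ℝ)⁻¹) ^ k / (1 - (L : ℝ)⁻¹)) := by
  obtain ⟨cinf, hlim, hrate⟩ := unitCovB_tendsto L M a ha hL
  have hL1 : (1 : ℝ) < L := by exact_mod_cast (lt_of_lt_of_le one_lt_two hL : 1 < L)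
  obtain ⟨hinf, hti, hb⟩ := inverse_tower_of_coercive hγ hco hlim (inv_nonneg.mpr (Nat.cast_nonneg _))
    (inv_lt_one_of_one_lt₀ hL1) hrate
  exact ⟨cinf, hlim, hinf, hti, hb⟩

end UnitLattice

end Summit.QuantumFields.BalabanUV.T4Continuum.CoerciveInverseTower

end
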